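import Mathlib
import Summits.CriticalPhenomena.Ising3DConformalLimit.Theses.GaussianScaleMixture
import Summits.CriticalPhenomena.Ising3DConformalLimit.Theorems.GaussianScaleMixtureCriticalTwoPointGSMGsmClosureOfTight
import Summits.CriticalPhenomena.Ising3DConformalLimit.Theorems.GaussianScaleMixtureCriticalTwoPointGSMExistsExchangeableRepOfRep

/-!
# `CriticalTwoPointGSM` ⇔ the critical two-point function is a tight-GSM limit

Route `GaussianScaleMixture` of `Ising3DConformalLimit`, crux `CriticalTwoPointGSM`
(stmt-CriticalPhenomena-8365), line `Sketch`: the ABSTRACT form of the line's transfer, with the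
approximating kernels left free. The crux holds as soon as `criticalTwoPoint 3` is the pointwise
limit on `ℤ³` of ANY sequence of kernels `G n` that are Gaussian scale mixtures with probability
mixing measures on the closed octant forming a tight family — subcritical two-point functions
(`Theorems/GaussianScaleMixtureCriticalTwoPointGSMSubcriticalTransfer.lean`), finite-volume (torus /
box) two-point functions at `β_c`, high-temperature or truncated expansions, … — and conversely
(constant sequence), so this is a CHARACTERISATION of the crux: every future line only has to
produce tight GSM approximants.

Contents: `criticalTwoPointGSM_of_tightApproximants` (registered stub of line `Sketch`; composition
of the landed stubs `gsmClosure_of_tight`, p86198, and `exists_exchangeable_rep_of_rep`, p88466) and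
`criticalTwoPointGSM_iff_tightApproximants`.
-/

namespace Summit.CriticalPhenomena.Ising3DConformalLimit.Theorems

open MeasureTheory Filter Topology
open Literature.Probability.LatticeModels
open Summit.CriticalPhenomena.Ising3DConformalLimit.Theses.GaussianScaleMixture (CriticalTwoPointGSM)
open scoped BigOperators

/-- **Tight GSM approximants give the crux.** If kernels `G n : ℤ³ → ℝ` are Gaussian scale
mixtures `G n x = ∫ exp(-∑ sᵢxᵢ²) dνₙ` with probability measures `νₙ` carried by the closed octant,
`{νₙ}` is tight, and `G n → criticalTwoPoint 3` pointwise on `ℤ³`, then `CriticalTwoPointGSM`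
holds (closure of the probability-GSM cone under tight limits, then `S₃`-symmetrisation). -/
theorem criticalTwoPointGSM_of_tightApproximants
    (h : ∃ (G : ℕ → Site 3 → ℝ) (ν : ℕ → Measure (Fin 3 → ℝ)),
      (∀ n, IsProbabilityMeasure (ν n)) ∧ (∀ n, (ν n) {s | ∃ i, s i < 0} = 0) ∧
      (∀ n (x : Site 3), G n x = ∫ s, Real.exp (-∑ i, s i * ((x i : ℝ)) ^ 2) ∂(ν n)) ∧
      IsTightMeasureSet (Set.range ν) ∧
      ∀ x : Site 3, Tendsto (fun n => G n x) atTop (𝓝 (criticalTwoPoint 3 x))) :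
    CriticalTwoPointGSM := by
  obtain ⟨G, ν, hP, hoct, hrep, htight, hlim⟩ := h
  obtain ⟨μ, hμP, hμoct, hμrep⟩ := gsmClosure_of_tight G (criticalTwoPoint 3) ν hP hoct hrep htight hlim
  exact exists_exchangeable_rep_of_rep μ hμP hμoct hμrep

/-- **Characterisation.** `CriticalTwoPointGSM` holds iff `criticalTwoPoint 3` is the pointwise
limit of Gaussian-scale-mixture kernels with tight probability mixing measures on the closed octant
(⇐ as above; ⇒ with the constant sequence, a single probability measure being a tight family). -/
theorem criticalTwoPointGSM_iff_tightApproximants :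
    CriticalTwoPointGSM ↔
      ∃ (G : ℕ → Site 3 → ℝ) (ν : ℕ → Measure (Fin 3 → ℝ)),
        (∀ n, IsProbabilityMeasure (ν n)) ∧ (∀ n, (ν n) {s | ∃ i, s i < 0} = 0) ∧
        (∀ n (x : Site 3), G n x = ∫ s, Real.exp (-∑ i, s i * ((x i : ℝ)) ^ 2) ∂(ν n)) ∧
        IsTightMeasureSet (Set.range ν) ∧
        ∀ x : Site 3, Tendsto (fun n => G n x) atTop (𝓝 (criticalTwoPoint 3 x)) := by
  refine ⟨fun h => ?_, fun h => criticalTwoPointGSM_of_tightApproximants h⟩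
  obtain ⟨ν, hP, hoct, -, hrep⟩ := h
  refine ⟨fun _ => criticalTwoPoint 3, fun _ => ν, fun _ => hP, fun _ => hoct, fun _ x => hrep x,
    ?_, fun x => tendsto_const_nhds⟩
  -- a single probability measure on a Polish space is a tight family
  have hrange : Set.range (fun _ : ℕ => ν) = {ν} := by
    ext ρ
    simp only [Set.mem_range, Set.mem_singleton_iff, exists_const]
    exact eq_comm
  rw [hrange]
  exact isTightMeasureSet_singleton

end Summit.CriticalPhenomena.Ising3DConformalLimit.Theorems
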